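import Literature.NumberTheory.Sieve.HeathBrownCubicSiegelWalfisz
import Literature.NumberTheory.Sieve.HeathBrownCubicWCalculus
import Literature.NumberTheory.Sieve.HeathBrownCubicLatticeCount
import HarnessLib

/-!
# Heath-Brown's (8.5): residue-class sums of `w'(N(β))` over a cube against the integral `𝓘`

Ninth layer of the decomposition of **parity.S18**
(`Literature.NumberTheory.Sieve.setOf_prime_cube_add_two_mul_cube_infinite`) along D. R. Heath-Brown,
*Primes represented by `x³ + 2y³`*, Acta Math. 186 (2001), 1–84, continuing
`HeathBrownCubicSiegelWalfisz` (which reduced **Lemma 3.8**, the named fact `HeathBrown2001_lemma_3_8`,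
to Lemmas 8.1 and 9.2 taken as hypotheses, `HeathBrown2001_lemma_3_8_of`) and `HeathBrownCubicWCalculus`
(the calculus (8.3)–(8.4) of the weight `w(t, 𝐦)`, whose header lists "(8.5) and the counting near the
boundary (Lemma 4.9)" as NOT done). This file PROVES the geometric step **(8.5)** of the proof of
Lemma 8.1 (p. 49) in the case `n ≥ 1`:

> "For each vector `β` we take `C(β)` to be the cube of side `r`, centred at `β`, and with sides
> parallel to those of `𝒞`. Then, since `r ≤ N(J)q³ ≤ L² ≤ S₀ ≪ V^{1/3}`, we have
> `N(𝐱) = N(β) + O(V^{2/3}r)` for any `𝐱 ∈ C(β)`. Thus (8.3) shows that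
> `w'(N(𝐱)) = w'(N(β)) + O(V^{−1/3}r(ξ log X)^{n−1})`, whence
> `w'(N(β)) = r⁻³ ∫_{C(β)} w'(N(𝐱)) dx dy dz + O(V^{−1/3}r(ξ log X)^{n−1})`. The cubes `C(β)` for
> `β ≡ γ (mod r)` will be disjoint, except for their boundaries. Moreover as `β` runs over `𝒞` the
> union of the cubes `C(β)` will be a set which differs from `𝒞` only at points within a distance `O(r)`
> of the boundary. Since `r ≤ S₀` it follows that
> `∑_{β ∈ 𝒞, β ≡ γ (mod r)} w'(N(β)) = r⁻³ ∑ ∫_{C(β)} w'(N(𝐱)) + O(V^{−1/3}r(ξ log X)^{n−1}(S₀/r)³)`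
> `= r⁻³ ∫_𝒞 w'(N(𝐱)) dx dy dz + O(r⁻³ · rS₀² · (ξ log X)^n) + O(V^{−1/3}r(ξ log X)^{n−1}(S₀/r)³)`
> `= r⁻³𝓘 + O(r⁻²S₀²(ξ log X)^n)`, by (8.4)." (8.5)

Here `𝒞 = ∏ (a_j, a_j + S₀]` is a cube as in Lemma 3.8, `r` a positive rational integer, the
congruence `β ≡ γ (mod r)` in `ℤ[2^{1/3}]` is the coordinatewise congruence `β̂ ≡ γ̂ (mod r)` of the
coordinate vectors (proved here from the integral basis `1, θ, θ²` of `HeathBrownCubicLatticeCount`: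
`natCast_dvd_coordElt_iff`, `cubeClassSum_coordElt`), and `𝓘 = ∫_𝒞 w'(N(𝐱))` is `cubeIntegral` of `HeathBrownCubicSiegelWalfisz`.

## Content (namespace `Literature.NumberTheory.Sieve.CubicSieve`)

* An abstract Riemann-sum lemma for a class `γ + rℤ³` in a cube, **`abs_sum_latticeCube_sub_integral_le`**:
  for `1 ≤ r ≤ S₀` and `g` integrable on `𝒞` with `|g| ≤ B` on `𝒞` and `|g(𝐱) − g(𝐲)| ≤ Λ` whenever
  `𝐱, 𝐲 ∈ 𝒞` differ by at most `r` in each coordinate,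
  `|∑_{v ∈ 𝒞 ∩ ℤ³, v ≡ γ (mod r)} g(v) − r⁻³ ∫_𝒞 g| ≤ 27(S₀/r)³Λ + 108(S₀/r)²B`.
  The cells used are `C(v) = ∏ (v_j − r, v_j]` (the lattice point at the UPPER corner rather than the
  centre — they tile `ℝ³` exactly, with no shared boundaries); the cells meeting `𝒞` are indexed by the
  window `cellWindow₃ = ∏_j (⌊(a_j − γ_j)/r⌋, ⌈(a_j + S₀ − γ_j)/r⌉]` of `w ∈ ℤ³` (`v = γ + rw`), of which
  at most `(S₀/r + 2)³` exist and at most `6(S₀/r + 2)²` are not interior (`card_cellWindow₃_le`,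
  `card_filter_not_cellInterior₃_le`); `∫_𝒞 g = ∑_w ∫_{C(γ+rw) ∩ 𝒞} g` (`integral_realCube_eq_sum_cells`);
  an interior cell contributes `|r³g(v) − ∫_{C(v)} g| ≤ r³Λ`, any cell at most `2r³B`.
* `abs_normForm_sub_le`: `|N(𝐱) − N(𝐲)| ≤ 39R²δ` for coordinates bounded by `R` and differing by `≤ δ`.
* **`HeathBrown2001_eq_8_5`** — (8.5) for `𝐦` of length `n + 2` (the paper's `n ≥ 1`), `X ≥ 1`, `τ ≥ 0`,
  a cube satisfying `CubeCond c₃ c₄ V` (`|x|, |y|, |z| ≤ c₃V^{1/3}`, `N ≥ c₄V` on `𝒞`), `1 ≤ r ≤ S₀`: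
  `|∑_{β̂ ∈ 𝒞, β̂ ≡ γ̂ (mod r)} w'(N(β̂)) − r⁻³𝓘| ≤ 2106(c₃²/c₄)(S₀³/r²)V^{−1/3}(ξ log X)^n + 108(S₀²/r²)(ξ log X)^{n+1}`,
  i.e. the two printed `O`-terms with explicit constants (via (8.3) as `abs_wDeriv_sub_wDeriv_le` and
  (8.4) as `wDeriv_le` of `HeathBrownCubicWCalculus`). The paper's last line `= r⁻³𝓘 + O(r⁻²S₀²(ξ log X)^n)`
  additionally uses `S₀ ≪ V^{1/3}` and `ξ log X ≫ 1`, facts of the application (Lemma 8.1) that are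
  not imposed here.
* From the integral basis `1, θ, θ²` of `𝓞_K = ℤ[2^{1/3}]` (`basis3` of `HeathBrownCubicLatticeCount`):
  the coordinates of `coordElt` (`repr_coordElt`), `natCast_dvd_coordElt_iff`, and the translation of
  `cubeClassSum w q (coordElt γ̂)` into a sum over `β̂ ≡ γ̂ (mod q)` coordinatewise (`cubeClassSum_coordElt`).

What is NOT here: the case `n = 0` of (8.5) (where `w'` is an indicator function and Lemma 4.9 replaces
(8.3)), the passage from the conditions `J ∣ β`, `β ≡ α (mod q)` to classes modulo `r = N([J, q])`
(p. 48, p. 50), and the rest of the proof of Lemma 8.1 ((8.7) and the Möbius sums, pp. 50–51).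

## References

* D. R. Heath-Brown, *Primes represented by `x³ + 2y³`*, Acta Math. 186 (2001), 1–84: §8, proof of
  Lemma 8.1, display (8.5) and the paragraph before it (p. 49). [cite: HeathBrownActa2001, §8 (8.5)]

## Mathlib / tree search

Mathlib has Riemann-sum/box-integral machinery (`BoxIntegral`) but no ready comparison of a lattice
residue-class sum with an integral over a product of `Ioc`s; used `MeasureTheory.integral_biUnion_finset`,
`norm_setIntegral_le_of_norm_le_const`, `setIntegral_const`, `Measure.volume_eq_prod`/`Measure.prod_prod`,
`Real.volume_Ioc`, `Finset.sum_nbij'`, `Int.floor_lt`/`Int.le_floor`/`Int.lt_ceil`/`Int.ceil_le`,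
`Module.Basis.repr_sum_self`. Tree: `HeathBrownCubicTypeII` (`latticeCube`, `realCube`, `coordElt`,
`CubeCond`, `wDeriv`, `hbXi`), `HeathBrownCubicSiegelWalfisz` (`normForm`, `cubeIntegral`, `cubeClassSum`),
`HeathBrownCubicWCalculus` (`wDeriv_nonneg`, `wDeriv_le`, `abs_wDeriv_sub_wDeriv_le`, `measurable_wDeriv`),
`HeathBrownCubicLatticeCount` (`basis3`, `coordFun`, `coordElt_eq_sum_smul`, `coordElt_sub`,
`coordElt_surjective`; its residue counts `card_cubeMod_filter_mem_mul_absNorm` will serve the passage to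
classes modulo `N([J, q])`).
-/

noncomputable section

open MeasureTheory Set Filter Topology Finset

namespace Literature.NumberTheory.Sieve.CubicSieve

/-! ### One coordinate: the cells `(γ + rw − r, γ + rw]` of the progression `γ + rℤ` -/

section OneDim

/-- The window of cell indices: the `w ∈ ℤ` whose cell `(γ + rw − r, γ + rw]` meets the interval
`(a, a + S₀]`, namely `⌊(a − γ)/r⌋ < w ≤ ⌈(a + S₀ − γ)/r⌉`. [folklore] -/
def cellWindow (a S₀ : ℝ) (γ : ℤ) (r : ℕ) : Finset ℤ :=
  Finset.Ioc ⌊(a - γ) / r⌋ ⌈(a + S₀ - γ) / r⌉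

/-- The vertex `γ + rw` of the cell with index `w`, as a real number. [folklore] -/
def cellVertex (γ : ℤ) (r : ℕ) (w : ℤ) : ℝ := (γ : ℝ) + (r : ℝ) * (w : ℝ)

/-- The cell `(γ + rw − r, γ + rw]` of index `w`. [folklore] -/
def cell₁ (γ : ℤ) (r : ℕ) (w : ℤ) : Set ℝ := Set.Ioc (cellVertex γ r w - r) (cellVertex γ r w)

/-- A cell index is *interior* for `(a, a + S₀]` when its whole cell lies inside:
`a + r ≤ γ + rw ≤ a + S₀`. [folklore] -/
def CellInterior (a S₀ : ℝ) (γ : ℤ) (r : ℕ) (w : ℤ) : Prop :=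
  a + r ≤ cellVertex γ r w ∧ cellVertex γ r w ≤ a + S₀

/-- Membership in the window: the cell of `w` meets `(a, a + S₀]`, i.e. `a < γ + rw < a + S₀ + r`. [folklore] -/
theorem mem_cellWindow_iff {a S₀ : ℝ} {γ : ℤ} {r : ℕ} (hr : 0 < r) {w : ℤ} :
    w ∈ cellWindow a S₀ γ r ↔ a < cellVertex γ r w ∧ cellVertex γ r w < a + S₀ + r := by
  have hr' : (0 : ℝ) < r := by exact_mod_cast hr
  rw [cellWindow, Finset.mem_Ioc, Int.floor_lt, cellVertex]
  constructor
  · rintro ⟨h1, h2⟩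
    have h2' : ((w : ℝ)) < (a + S₀ - γ) / r + 1 := by
      have := Int.lt_ceil.mp (show w - 1 < ⌈(a + S₀ - ↑γ) / ↑r⌉ by omega)
      push_cast at this
      linarith
    rw [div_lt_iff₀ hr'] at h1
    have h3 : ((w : ℝ) - 1) * r < a + S₀ - γ := by
      have := (sub_lt_iff_lt_add).mpr h2'
      rwa [lt_div_iff₀ hr'] at this
    constructor <;> nlinarith
  · rintro ⟨h1, h2⟩
    constructor
    · rw [div_lt_iff₀ hr']; linarith
    · have h3 : ((w : ℝ) - 1) < (a + S₀ - γ) / r := by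
        rw [lt_div_iff₀ hr']; nlinarith
      have : w - 1 < ⌈(a + S₀ - ↑γ) / ↑r⌉ := Int.lt_ceil.mpr (by push_cast; exact h3)
      omega

/-- The vertex lies in its cell. [folklore] -/
theorem cellVertex_mem_cell₁ (γ : ℤ) {r : ℕ} (hr : 0 < r) (w : ℤ) : cellVertex γ r w ∈ cell₁ γ r w := by
  have hr' : (0 : ℝ) < r := by exact_mod_cast hr
  exact ⟨by linarith, le_rfl⟩

/-- Every point of `(a, a + S₀]` lies in the cell of index `⌈(x − γ)/r⌉`, which belongs to the window.
[folklore] -/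
theorem exists_mem_cellWindow_mem_cell₁ {a S₀ : ℝ} (γ : ℤ) {r : ℕ} (hr : 0 < r) {x : ℝ}
    (hx : x ∈ Set.Ioc a (a + S₀)) : ∃ w ∈ cellWindow a S₀ γ r, x ∈ cell₁ γ r w := by
  have hr' : (0 : ℝ) < r := by exact_mod_cast hr
  have h1 := Int.le_ceil ((x - γ) / r)
  have h2 := Int.ceil_lt_add_one ((x - γ) / r)
  rw [div_le_iff₀ hr'] at h1
  have h2' : (⌈(x - γ) / r⌉ : ℝ) * r < x - γ + r := by
    have := mul_lt_mul_of_pos_right h2 hr'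
    rwa [add_mul, div_mul_cancel₀ _ hr'.ne', one_mul] at this
  refine ⟨⌈(x - γ) / r⌉, ?_, ?_⟩
  · rw [mem_cellWindow_iff hr, cellVertex]
    constructor <;> nlinarith [hx.1, hx.2]
  · simp only [cell₁, cellVertex, Set.mem_Ioc]
    constructor <;> nlinarith

/-- The window has at most `S₀/r + 2` indices (`S₀ ≥ 0`). [folklore] -/
theorem card_cellWindow_le {a S₀ : ℝ} (hS₀ : 0 ≤ S₀) (γ : ℤ) {r : ℕ} (hr : 0 < r) :
    ((cellWindow a S₀ γ r).card : ℝ) ≤ S₀ / r + 2 := by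
  have hr' : (0 : ℝ) < r := by exact_mod_cast hr
  rw [cellWindow, Int.card_Ioc]
  have h1 := Int.lt_floor_add_one ((a - γ) / r)
  have h2 := Int.ceil_lt_add_one ((a + S₀ - γ) / r)
  have hS : 0 ≤ S₀ / r + 2 := by positivity
  have hdiff : ((⌈(a + S₀ - ↑γ) / ↑r⌉ - ⌊(a - ↑γ) / ↑r⌋ : ℤ) : ℝ) ≤ S₀ / r + 2 := by
    push_cast
    have : (a + S₀ - γ) / r - (a - γ) / r = S₀ / r := by ring
    linarith
  rcases le_or_gt (⌈(a + S₀ - ↑γ) / ↑r⌉ - ⌊(a - ↑γ) / ↑r⌋) 0 with h | h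
  · rw [Int.toNat_of_nonpos h]; simpa using hS
  · have : (((⌈(a + S₀ - ↑γ) / ↑r⌉ - ⌊(a - ↑γ) / ↑r⌋).toNat : ℤ) : ℝ) ≤ S₀ / r + 2 := by
      rw [Int.toNat_of_nonneg h.le]; exact hdiff
    exact_mod_cast this

/-- A non-interior index of the window is one of the two extreme ones. [folklore] -/
theorem eq_or_eq_of_not_cellInterior {a S₀ : ℝ} {γ : ℤ} {r : ℕ} (hr : 0 < r) {w : ℤ}
    (hw : w ∈ cellWindow a S₀ γ r) (hni : ¬CellInterior a S₀ γ r w) :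
    w = ⌊(a - γ) / r⌋ + 1 ∨ w = ⌈(a + S₀ - γ) / r⌉ := by
  have hr' : (0 : ℝ) < r := by exact_mod_cast hr
  have hw' := hw
  rw [mem_cellWindow_iff hr] at hw'
  rw [cellWindow, Finset.mem_Ioc] at hw
  rw [CellInterior, not_and_or, not_le, not_le] at hni
  unfold cellVertex at hni hw'
  rcases hni with h | h
  · left
    -- `(a - γ)/r < w < (a - γ)/r + 1`
    have hlt : (w : ℝ) < (a - γ) / r + 1 := by
      rw [div_add_one hr'.ne', lt_div_iff₀ hr']; nlinarith
    have h2 : w - 1 ≤ ⌊(a - ↑γ) / ↑r⌋ := Int.le_floor.mpr (by push_cast; linarith)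
    omega
  · right
    have hgt : (a + S₀ - γ) / r < w := by
      rw [div_lt_iff₀ hr']; nlinarith
    have := Int.ceil_le.mpr (show (a + S₀ - γ) / r ≤ ((w : ℤ) : ℝ) from hgt.le)
    omega

open scoped Classical in
/-- At most two indices of the window are non-interior. [folklore] -/
theorem card_filter_not_cellInterior_le (a S₀ : ℝ) (γ : ℤ) {r : ℕ} (hr : 0 < r) :
    ((cellWindow a S₀ γ r).filter (fun w => ¬CellInterior a S₀ γ r w)).card ≤ 2 := by
  calc ((cellWindow a S₀ γ r).filter (fun w => ¬CellInterior a S₀ γ r w)).card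
      ≤ ({⌊(a - γ) / r⌋ + 1, ⌈(a + S₀ - γ) / r⌉} : Finset ℤ).card := by
        refine Finset.card_le_card fun w hw => ?_
        rw [Finset.mem_filter] at hw
        rcases eq_or_eq_of_not_cellInterior hr hw.1 hw.2 with h | h <;> simp [h]
    _ ≤ 2 := Finset.card_le_two

/-- An interior cell lies inside the interval, and so does its vertex. [folklore] -/
theorem cell₁_subset_of_cellInterior {a S₀ : ℝ} {γ : ℤ} {r : ℕ} {w : ℤ}
    (h : CellInterior a S₀ γ r w) : cell₁ γ r w ⊆ Set.Ioc a (a + S₀) := by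
  intro x hx
  exact ⟨by linarith [h.1, hx.1], hx.2.trans h.2⟩

/-- The vertex of an interior cell lies in the interval. [folklore] -/
theorem cellVertex_mem_of_cellInterior {a S₀ : ℝ} {γ : ℤ} {r : ℕ} (hr : 0 < r) {w : ℤ}
    (h : CellInterior a S₀ γ r w) : cellVertex γ r w ∈ Set.Ioc a (a + S₀) :=
  cell₁_subset_of_cellInterior h (cellVertex_mem_cell₁ γ hr w)

/-- An index whose vertex lies in the interval belongs to the window. [folklore] -/
theorem mem_cellWindow_of_vertex_mem {a S₀ : ℝ} {γ : ℤ} {r : ℕ} (hr : 0 < r) {w : ℤ}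
    (h : cellVertex γ r w ∈ Set.Ioc a (a + S₀)) : w ∈ cellWindow a S₀ γ r := by
  have hr' : (0 : ℝ) < r := by exact_mod_cast hr
  rw [mem_cellWindow_iff hr]
  exact ⟨h.1, by linarith [h.2]⟩

/-- Distinct indices have disjoint cells. [folklore] -/
theorem disjoint_cell₁ (γ : ℤ) (r : ℕ) {w w' : ℤ} (h : w ≠ w') : Disjoint (cell₁ γ r w) (cell₁ γ r w') := by
  have hr' : (0 : ℝ) ≤ r := Nat.cast_nonneg r
  wlog hlt : w < w' generalizing w w'
  · exact (this h.symm (lt_of_le_of_ne (not_lt.mp hlt) h.symm)).symm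
  rw [Set.disjoint_iff]
  rintro x ⟨hx, hx'⟩
  simp only [cell₁, cellVertex, Set.mem_Ioc] at hx hx'
  have : (w : ℝ) + 1 ≤ w' := by exact_mod_cast hlt
  nlinarith [hx.2, hx'.1]

/-- A point of a cell is within `r` of the vertex (to its left). [folklore] -/
theorem abs_sub_cellVertex_le {γ : ℤ} {r : ℕ} {w : ℤ} {x : ℝ} (hx : x ∈ cell₁ γ r w) :
    |x - cellVertex γ r w| ≤ r := by
  rw [abs_le]; exact ⟨by linarith [hx.1], by linarith [hx.2, (Nat.cast_nonneg r : (0:ℝ) ≤ r)]⟩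

/-- The integers `v ∈ (⌊a⌋, ⌊a + S₀⌋]` are the integers in `(a, a + S₀]`. [folklore] -/
theorem mem_Ioc_floor_iff {a S₀ : ℝ} {v : ℤ} :
    v ∈ Finset.Ioc ⌊a⌋ ⌊a + S₀⌋ ↔ (v : ℝ) ∈ Set.Ioc a (a + S₀) := by
  rw [Finset.mem_Ioc, Int.floor_lt, Int.le_floor, Set.mem_Ioc]

end OneDim

/-! ### Three coordinates: the cells of `γ + rℤ³` against the cube `𝒞 = ∏ (a_j, a_j + S₀]` -/

section ThreeDim

variable (a : ℝ × ℝ × ℝ) (S₀ : ℝ) (γ : ℤ × ℤ × ℤ) (r : ℕ)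

/-- The window of cell indices `w ∈ ℤ³` (product of the three one-dimensional windows). [folklore] -/
def cellWindow₃ : Finset (ℤ × ℤ × ℤ) :=
  cellWindow a.1 S₀ γ.1 r ×ˢ (cellWindow a.2.1 S₀ γ.2.1 r ×ˢ cellWindow a.2.2 S₀ γ.2.2 r)

/-- The vertex `γ + rw ∈ γ + rℤ³` of index `w`, as a real vector. [folklore] -/
def cellVertex₃ (w : ℤ × ℤ × ℤ) : ℝ × ℝ × ℝ :=
  (cellVertex γ.1 r w.1, cellVertex γ.2.1 r w.2.1, cellVertex γ.2.2 r w.2.2)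

/-- The cell `∏_j (γ_j + rw_j − r, γ_j + rw_j]` of index `w`: a cube of side `r` with the vertex
`γ + rw` at its upper corner. [folklore] -/
def cell₃ (w : ℤ × ℤ × ℤ) : Set (ℝ × ℝ × ℝ) :=
  cell₁ γ.1 r w.1 ×ˢ (cell₁ γ.2.1 r w.2.1 ×ˢ cell₁ γ.2.2 r w.2.2)

/-- Interior indices: the whole cell lies in the cube. [folklore] -/
def CellInterior₃ (w : ℤ × ℤ × ℤ) : Prop :=
  CellInterior a.1 S₀ γ.1 r w.1 ∧ CellInterior a.2.1 S₀ γ.2.1 r w.2.1 ∧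
    CellInterior a.2.2 S₀ γ.2.2 r w.2.2

variable {a S₀ γ r}

/-- Membership in the window of `ℤ³`, coordinatewise. [folklore] -/
theorem mem_cellWindow₃ {w : ℤ × ℤ × ℤ} :
    w ∈ cellWindow₃ a S₀ γ r ↔ w.1 ∈ cellWindow a.1 S₀ γ.1 r ∧ w.2.1 ∈ cellWindow a.2.1 S₀ γ.2.1 r ∧
      w.2.2 ∈ cellWindow a.2.2 S₀ γ.2.2 r := by
  simp only [cellWindow₃, Finset.mem_product]

/-- Membership in a cell, coordinatewise. [folklore] -/
theorem mem_cell₃ {w : ℤ × ℤ × ℤ} {x : ℝ × ℝ × ℝ} :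
    x ∈ cell₃ γ r w ↔ x.1 ∈ cell₁ γ.1 r w.1 ∧ x.2.1 ∈ cell₁ γ.2.1 r w.2.1 ∧ x.2.2 ∈ cell₁ γ.2.2 r w.2.2 := by
  simp only [cell₃, Set.mem_prod]

/-- Membership in the cube `𝒞 = ∏ (a_j, a_j + S₀]`, coordinatewise. [cite: HeathBrownActa2001, Lemma 3.8] -/
theorem mem_realCube {x : ℝ × ℝ × ℝ} :
    x ∈ realCube a S₀ ↔ x.1 ∈ Set.Ioc a.1 (a.1 + S₀) ∧ x.2.1 ∈ Set.Ioc a.2.1 (a.2.1 + S₀) ∧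
      x.2.2 ∈ Set.Ioc a.2.2 (a.2.2 + S₀) := by
  simp only [realCube, Set.mem_prod]

/-- The cube is measurable. [folklore] -/
theorem measurableSet_realCube (a : ℝ × ℝ × ℝ) (S₀ : ℝ) : MeasurableSet (realCube a S₀) :=
  measurableSet_Ioc.prod (measurableSet_Ioc.prod measurableSet_Ioc)

/-- The cells are measurable. [folklore] -/
theorem measurableSet_cell₃ (γ : ℤ × ℤ × ℤ) (r : ℕ) (w : ℤ × ℤ × ℤ) : MeasurableSet (cell₃ γ r w) :=
  measurableSet_Ioc.prod (measurableSet_Ioc.prod measurableSet_Ioc)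

/-- The cells have volume `r³`. [folklore] -/
theorem volume_cell₃ (γ : ℤ × ℤ × ℤ) (r : ℕ) (w : ℤ × ℤ × ℤ) :
    volume (cell₃ γ r w) = ENNReal.ofReal ((r : ℝ) ^ 3) := by
  have hr : (0 : ℝ) ≤ r := Nat.cast_nonneg r
  rw [cell₃, Measure.volume_eq_prod, Measure.prod_prod, Measure.volume_eq_prod, Measure.prod_prod]
  simp only [cell₁, Real.volume_Ioc, sub_sub_cancel]
  rw [← ENNReal.ofReal_mul hr, ← ENNReal.ofReal_mul hr]
  ring_nf

/-- The cells have finite volume. [folklore] -/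
theorem volume_cell₃_lt_top (γ : ℤ × ℤ × ℤ) (r : ℕ) (w : ℤ × ℤ × ℤ) : volume (cell₃ γ r w) < ⊤ := by
  rw [volume_cell₃]; exact ENNReal.ofReal_lt_top

/-- The vertex `γ + rw` lies in its cell. [folklore] -/
theorem cellVertex₃_mem_cell₃ (γ : ℤ × ℤ × ℤ) (hr : 0 < r) (w : ℤ × ℤ × ℤ) :
    cellVertex₃ γ r w ∈ cell₃ γ r w :=
  mem_cell₃.mpr ⟨cellVertex_mem_cell₁ _ hr _, cellVertex_mem_cell₁ _ hr _, cellVertex_mem_cell₁ _ hr _⟩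

/-- Distinct indices have disjoint cells. [folklore] -/
theorem disjoint_cell₃ (γ : ℤ × ℤ × ℤ) (r : ℕ) {w w' : ℤ × ℤ × ℤ} (h : w ≠ w') :
    Disjoint (cell₃ γ r w) (cell₃ γ r w') := by
  rw [cell₃, cell₃, Set.disjoint_prod, Set.disjoint_prod]
  by_cases h1 : w.1 = w'.1
  · right
    by_cases h2 : w.2.1 = w'.2.1
    · right
      refine disjoint_cell₁ _ _ fun h3 => h ?_
      exact Prod.ext h1 (Prod.ext h2 h3)
    · exact Or.inl (disjoint_cell₁ _ _ h2)
  · exact Or.inl (disjoint_cell₁ _ _ h1)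

/-- **The cells of the window cover the cube.** [folklore] -/
theorem realCube_eq_biUnion (hr : 0 < r) :
    realCube a S₀ = ⋃ w ∈ cellWindow₃ a S₀ γ r, cell₃ γ r w ∩ realCube a S₀ := by
  ext x
  simp only [Set.mem_iUnion, Set.mem_inter_iff, exists_prop]
  constructor
  · intro hx
    have hx' := mem_realCube.mp hx
    obtain ⟨w₁, hw₁, hx₁⟩ := exists_mem_cellWindow_mem_cell₁ γ.1 hr hx'.1
    obtain ⟨w₂, hw₂, hx₂⟩ := exists_mem_cellWindow_mem_cell₁ γ.2.1 hr hx'.2.1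
    obtain ⟨w₃, hw₃, hx₃⟩ := exists_mem_cellWindow_mem_cell₁ γ.2.2 hr hx'.2.2
    exact ⟨(w₁, w₂, w₃), mem_cellWindow₃.mpr ⟨hw₁, hw₂, hw₃⟩, mem_cell₃.mpr ⟨hx₁, hx₂, hx₃⟩, hx⟩
  · rintro ⟨w, -, -, hx⟩
    exact hx

/-- An interior cell lies in the cube. [folklore] -/
theorem cell₃_subset_realCube {w : ℤ × ℤ × ℤ} (h : CellInterior₃ a S₀ γ r w) :
    cell₃ γ r w ⊆ realCube a S₀ := fun _ hx =>
  let hx' := mem_cell₃.mp hx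
  mem_realCube.mpr ⟨cell₁_subset_of_cellInterior h.1 hx'.1, cell₁_subset_of_cellInterior h.2.1 hx'.2.1,
    cell₁_subset_of_cellInterior h.2.2 hx'.2.2⟩

/-- An index whose vertex lies in the cube belongs to the window. [folklore] -/
theorem mem_cellWindow₃_of_vertex_mem (hr : 0 < r) {w : ℤ × ℤ × ℤ}
    (h : cellVertex₃ γ r w ∈ realCube a S₀) : w ∈ cellWindow₃ a S₀ γ r := by
  have h' := mem_realCube.mp h
  exact mem_cellWindow₃.mpr ⟨mem_cellWindow_of_vertex_mem hr h'.1,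
    mem_cellWindow_of_vertex_mem hr h'.2.1, mem_cellWindow_of_vertex_mem hr h'.2.2⟩

/-- A point of a cell is within `r` of its vertex in each coordinate. [folklore] -/
theorem abs_sub_cellVertex₃_le {w : ℤ × ℤ × ℤ} {x : ℝ × ℝ × ℝ} (hx : x ∈ cell₃ γ r w) :
    |x.1 - (cellVertex₃ γ r w).1| ≤ r ∧ |x.2.1 - (cellVertex₃ γ r w).2.1| ≤ r ∧
      |x.2.2 - (cellVertex₃ γ r w).2.2| ≤ r :=
  let hx' := mem_cell₃.mp hx
  ⟨abs_sub_cellVertex_le hx'.1, abs_sub_cellVertex_le hx'.2.1, abs_sub_cellVertex_le hx'.2.2⟩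

/-- The window has at most `(S₀/r + 2)³` indices. [folklore] -/
theorem card_cellWindow₃_le (hS₀ : 0 ≤ S₀) (hr : 0 < r) :
    ((cellWindow₃ a S₀ γ r).card : ℝ) ≤ (S₀ / r + 2) ^ 3 := by
  rw [cellWindow₃, Finset.card_product, Finset.card_product]
  push_cast
  have h1 := card_cellWindow_le (a := a.1) hS₀ γ.1 hr
  have h2 := card_cellWindow_le (a := a.2.1) hS₀ γ.2.1 hr
  have h3 := card_cellWindow_le (a := a.2.2) hS₀ γ.2.2 hr
  have h0 : (0 : ℝ) ≤ S₀ / r + 2 := by positivity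
  calc ((cellWindow a.1 S₀ γ.1 r).card : ℝ) *
        (((cellWindow a.2.1 S₀ γ.2.1 r).card : ℝ) * ((cellWindow a.2.2 S₀ γ.2.2 r).card : ℝ))
      ≤ (S₀ / r + 2) * ((S₀ / r + 2) * (S₀ / r + 2)) := by gcongr
    _ = (S₀ / r + 2) ^ 3 := by ring

open scoped Classical in
/-- At most `6 (S₀/r + 2)²` indices of the window are not interior (a non-interior index has a
non-interior coordinate, of which there are at most two per axis). [folklore] -/
theorem card_filter_not_cellInterior₃_le (hS₀ : 0 ≤ S₀) (hr : 0 < r) :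
    (((cellWindow₃ a S₀ γ r).filter fun w => ¬CellInterior₃ a S₀ γ r w).card : ℝ) ≤
      6 * (S₀ / r + 2) ^ 2 := by
  set T₁ := cellWindow a.1 S₀ γ.1 r
  set T₂ := cellWindow a.2.1 S₀ γ.2.1 r
  set T₃ := cellWindow a.2.2 S₀ γ.2.2 r
  set B₁ := T₁.filter fun w => ¬CellInterior a.1 S₀ γ.1 r w
  set B₂ := T₂.filter fun w => ¬CellInterior a.2.1 S₀ γ.2.1 r w
  set B₃ := T₃.filter fun w => ¬CellInterior a.2.2 S₀ γ.2.2 r w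
  have hsub : ((cellWindow₃ a S₀ γ r).filter fun w => ¬CellInterior₃ a S₀ γ r w) ⊆
      B₁ ×ˢ (T₂ ×ˢ T₃) ∪ (T₁ ×ˢ (B₂ ×ˢ T₃) ∪ T₁ ×ˢ (T₂ ×ˢ B₃)) := by
    intro w hw
    rw [Finset.mem_filter, mem_cellWindow₃, CellInterior₃, not_and_or, not_and_or] at hw
    obtain ⟨⟨h1, h2, h3⟩, hni⟩ := hw
    simp only [Finset.mem_union, Finset.mem_product, B₁, B₂, B₃, Finset.mem_filter]
    tauto
  have hT₁ := card_cellWindow_le (a := a.1) hS₀ γ.1 hr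
  have hT₂ := card_cellWindow_le (a := a.2.1) hS₀ γ.2.1 hr
  have hT₃ := card_cellWindow_le (a := a.2.2) hS₀ γ.2.2 hr
  have hB₁ : (B₁.card : ℝ) ≤ 2 := by exact_mod_cast card_filter_not_cellInterior_le a.1 S₀ γ.1 hr
  have hB₂ : (B₂.card : ℝ) ≤ 2 := by exact_mod_cast card_filter_not_cellInterior_le a.2.1 S₀ γ.2.1 hr
  have hB₃ : (B₃.card : ℝ) ≤ 2 := by exact_mod_cast card_filter_not_cellInterior_le a.2.2 S₀ γ.2.2 hr
  have h0 : (0 : ℝ) ≤ S₀ / r + 2 := by positivity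
  have hN : ((cellWindow₃ a S₀ γ r).filter fun w => ¬CellInterior₃ a S₀ γ r w).card ≤
      B₁.card * (T₂.card * T₃.card) + (T₁.card * (B₂.card * T₃.card) +
        T₁.card * (T₂.card * B₃.card)) := by
    calc ((cellWindow₃ a S₀ γ r).filter fun w => ¬CellInterior₃ a S₀ γ r w).card
        ≤ (B₁ ×ˢ (T₂ ×ˢ T₃) ∪ (T₁ ×ˢ (B₂ ×ˢ T₃) ∪ T₁ ×ˢ (T₂ ×ˢ B₃))).card :=
          Finset.card_le_card hsub
      _ ≤ (B₁ ×ˢ (T₂ ×ˢ T₃)).card + ((T₁ ×ˢ (B₂ ×ˢ T₃)).card + (T₁ ×ˢ (T₂ ×ˢ B₃)).card) :=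
          (Finset.card_union_le _ _).trans (Nat.add_le_add_left (Finset.card_union_le _ _) _)
      _ = B₁.card * (T₂.card * T₃.card) + (T₁.card * (B₂.card * T₃.card) +
            T₁.card * (T₂.card * B₃.card)) := by
          simp only [Finset.card_product]
  have hR : (((cellWindow₃ a S₀ γ r).filter fun w => ¬CellInterior₃ a S₀ γ r w).card : ℝ) ≤
      (B₁.card : ℝ) * ((T₂.card : ℝ) * (T₃.card : ℝ)) + ((T₁.card : ℝ) * ((B₂.card : ℝ) * (T₃.card : ℝ)) +
        (T₁.card : ℝ) * ((T₂.card : ℝ) * (B₃.card : ℝ))) := by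
    exact_mod_cast hN
  calc (((cellWindow₃ a S₀ γ r).filter fun w => ¬CellInterior₃ a S₀ γ r w).card : ℝ)
      ≤ (B₁.card : ℝ) * ((T₂.card : ℝ) * (T₃.card : ℝ)) + ((T₁.card : ℝ) * ((B₂.card : ℝ) * (T₃.card : ℝ)) +
        (T₁.card : ℝ) * ((T₂.card : ℝ) * (B₃.card : ℝ))) := hR
    _ ≤ 2 * ((S₀ / r + 2) * (S₀ / r + 2)) + ((S₀ / r + 2) * (2 * (S₀ / r + 2)) +
          (S₀ / r + 2) * ((S₀ / r + 2) * 2)) := by gcongr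
    _ = 6 * (S₀ / r + 2) ^ 2 := by ring

/-- **The integral over the cube splits over the cells of the window.** [folklore] -/
theorem integral_realCube_eq_sum_cells (hr : 0 < r) {g : ℝ × ℝ × ℝ → ℝ}
    (hg : IntegrableOn g (realCube a S₀)) :
    ∫ x in realCube a S₀, g x =
      ∑ w ∈ cellWindow₃ a S₀ γ r, ∫ x in cell₃ γ r w ∩ realCube a S₀, g x := by
  conv_lhs => rw [realCube_eq_biUnion (a := a) (S₀ := S₀) (γ := γ) hr]
  refine integral_biUnion_finset _ (fun w _ => (measurableSet_cell₃ γ r w).inter (measurableSet_realCube a S₀))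
    (fun w _ w' _ hne => ?_) (fun w _ => hg.mono_set Set.inter_subset_right)
  exact (disjoint_cell₃ γ r hne).mono Set.inter_subset_left Set.inter_subset_left

end ThreeDim

/-! ### The abstract comparison: a residue-class sum over the cube against the integral -/

section Abstract

variable {a : ℝ × ℝ × ℝ} {S₀ : ℝ} {γ : ℤ × ℤ × ℤ} {r : ℕ}

open scoped Classical in
/-- **Riemann sums over a class `γ + rℤ³` in a cube** (the mechanism of (8.5), p. 49: "For each vector
`β` we take `C(β)` to be the cube of side `r` … the cubes `C(β)` for `β ≡ γ (mod r)` will be disjoint …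
as `β` runs over `𝒞` the union of the cubes `C(β)` will be a set which differs from `𝒞` only at points
within a distance `O(r)` of the boundary"). For a cube `𝒞 = ∏ (a_j, a_j + S₀]`, `1 ≤ r ≤ S₀`, and
`g` integrable on `𝒞` with `|g| ≤ B` on `𝒞` and `|g(x) − g(y)| ≤ Λ` whenever `x, y ∈ 𝒞` are within
`r` of each other in every coordinate:
`|∑_{v ∈ 𝒞 ∩ (γ + rℤ³)} g(v) − r⁻³ ∫_𝒞 g| ≤ 27 (S₀/r)³ Λ + 108 (S₀/r)² B`
(interior cells contribute `≤ r³Λ` each, the `≤ 6(S₀/r + 2)²` boundary cells `≤ 2r³B` each). The sum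
is written over the cell indices `w` of the window whose vertex `γ + rw` lies in `𝒞`. [folklore] -/
theorem abs_sum_cellVertex_sub_integral_le (hr : 0 < r) (hrS : (r : ℝ) ≤ S₀) {g : ℝ × ℝ × ℝ → ℝ}
    (hg : IntegrableOn g (realCube a S₀)) {B Λ : ℝ} (hB0 : 0 ≤ B) (hΛ0 : 0 ≤ Λ)
    (hB : ∀ x ∈ realCube a S₀, |g x| ≤ B)
    (hΛ : ∀ x ∈ realCube a S₀, ∀ y ∈ realCube a S₀, |x.1 - y.1| ≤ r → |x.2.1 - y.2.1| ≤ r →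
      |x.2.2 - y.2.2| ≤ r → |g x - g y| ≤ Λ) :
    |∑ w ∈ (cellWindow₃ a S₀ γ r).filter (fun w => cellVertex₃ γ r w ∈ realCube a S₀),
          g (cellVertex₃ γ r w) -
        ((r : ℝ) ^ 3)⁻¹ * ∫ x in realCube a S₀, g x| ≤
      27 * (S₀ / r) ^ 3 * Λ + 108 * (S₀ / r) ^ 2 * B := by
  have hr' : (0 : ℝ) < r := by exact_mod_cast hr
  have hS₀ : 0 < S₀ := hr'.trans_le hrS
  have hr3 : (0 : ℝ) < (r : ℝ) ^ 3 := by positivity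
  set W := cellWindow₃ a S₀ γ r with hW
  set 𝒞 := realCube a S₀ with h𝒞
  set V : ℤ × ℤ × ℤ → ℝ × ℝ × ℝ := fun w => cellVertex₃ γ r w with hV
  -- the integral over the cells, the sum over the window
  have hI : ∫ x in 𝒞, g x = ∑ w ∈ W, ∫ x in cell₃ γ r w ∩ 𝒞, g x :=
    integral_realCube_eq_sum_cells hr hg
  have hS : ∑ w ∈ W.filter (fun w => V w ∈ 𝒞), g (V w) =
      ∑ w ∈ W, if V w ∈ 𝒞 then g (V w) else 0 := Finset.sum_filter _ _
  set D : ℤ × ℤ × ℤ → ℝ := fun w =>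
    (r : ℝ) ^ 3 * (if V w ∈ 𝒞 then g (V w) else 0) - ∫ x in cell₃ γ r w ∩ 𝒞, g x with hD
  have hkey : (r : ℝ) ^ 3 * ∑ w ∈ W.filter (fun w => V w ∈ 𝒞), g (V w) - ∫ x in 𝒞, g x =
      ∑ w ∈ W, D w := by
    rw [hS, hI, Finset.mul_sum, ← Finset.sum_sub_distrib]
  -- volumes
  have hvol : ∀ w, volume (cell₃ γ r w ∩ 𝒞) ≤ ENNReal.ofReal ((r : ℝ) ^ 3) := fun w =>
    (measure_mono Set.inter_subset_left).trans_eq (volume_cell₃ γ r w)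
  have hvol_lt : ∀ w, volume (cell₃ γ r w ∩ 𝒞) < ⊤ := fun w =>
    (hvol w).trans_lt ENNReal.ofReal_lt_top
  have hreal : ∀ w, (volume (cell₃ γ r w ∩ 𝒞)).toReal ≤ (r : ℝ) ^ 3 := fun w => by
    have := ENNReal.toReal_mono ENNReal.ofReal_ne_top (hvol w)
    rwa [ENNReal.toReal_ofReal hr3.le] at this
  -- every cell: `|D w| ≤ 2r³B`
  have hDall : ∀ w ∈ W, |D w| ≤ 2 * (r : ℝ) ^ 3 * B := by
    intro w _
    have h1 : |(r : ℝ) ^ 3 * (if V w ∈ 𝒞 then g (V w) else 0)| ≤ (r : ℝ) ^ 3 * B := by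
      rw [abs_mul, abs_of_pos hr3]
      refine mul_le_mul_of_nonneg_left ?_ hr3.le
      split_ifs with h
      · exact hB _ h
      · simpa using hB0
    have h2 : |∫ x in cell₃ γ r w ∩ 𝒞, g x| ≤ (r : ℝ) ^ 3 * B := by
      have := norm_setIntegral_le_of_norm_le_const (hvol_lt w)
        (fun x hx => show ‖g x‖ ≤ B by rw [Real.norm_eq_abs]; exact hB x hx.2)
      rw [Real.norm_eq_abs, measureReal_def] at this
      calc |∫ x in cell₃ γ r w ∩ 𝒞, g x| ≤ B * (volume (cell₃ γ r w ∩ 𝒞)).toReal := this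
        _ ≤ B * (r : ℝ) ^ 3 := mul_le_mul_of_nonneg_left (hreal w) hB0
        _ = (r : ℝ) ^ 3 * B := mul_comm _ _
    calc |D w| ≤ |(r : ℝ) ^ 3 * (if V w ∈ 𝒞 then g (V w) else 0)| +
          |∫ x in cell₃ γ r w ∩ 𝒞, g x| := abs_sub _ _
      _ ≤ (r : ℝ) ^ 3 * B + (r : ℝ) ^ 3 * B := add_le_add h1 h2
      _ = 2 * (r : ℝ) ^ 3 * B := by ring
  -- interior cells: `|D w| ≤ r³Λ`
  have hDint : ∀ w ∈ W, CellInterior₃ a S₀ γ r w → |D w| ≤ (r : ℝ) ^ 3 * Λ := by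
    intro w _ hint
    have hsub : cell₃ γ r w ⊆ 𝒞 := cell₃_subset_realCube hint
    have hVcell : V w ∈ cell₃ γ r w := cellVertex₃_mem_cell₃ γ hr w
    have hV𝒞 : V w ∈ 𝒞 := hsub hVcell
    have hinter : cell₃ γ r w ∩ 𝒞 = cell₃ γ r w := Set.inter_eq_left.mpr hsub
    have hvolw : (volume (cell₃ γ r w)).toReal = (r : ℝ) ^ 3 := by
      rw [volume_cell₃, ENNReal.toReal_ofReal hr3.le]
    have hconst : ∫ _ in cell₃ γ r w, g (V w) = (r : ℝ) ^ 3 * g (V w) := by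
      rw [setIntegral_const, measureReal_def, hvolw, smul_eq_mul]
    have hgi : IntegrableOn g (cell₃ γ r w) := hg.mono_set hsub
    have hci : IntegrableOn (fun _ => g (V w)) (cell₃ γ r w) :=
      integrableOn_const (volume_cell₃_lt_top γ r w).ne
    have hDw : D w = ∫ x in cell₃ γ r w, (g (V w) - g x) := by
      simp only [hD, if_pos hV𝒞, hinter]
      rw [integral_sub hci hgi, hconst]
    rw [hDw]
    have hbound : ∀ x ∈ cell₃ γ r w, ‖g (V w) - g x‖ ≤ Λ := by
      intro x hx
      rw [Real.norm_eq_abs]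
      obtain ⟨d1, d2, d3⟩ := abs_sub_cellVertex₃_le hx
      refine hΛ (V w) hV𝒞 x (hsub hx) ?_ ?_ ?_
      · rw [abs_sub_comm]; exact d1
      · rw [abs_sub_comm]; exact d2
      · rw [abs_sub_comm]; exact d3
    have := norm_setIntegral_le_of_norm_le_const (volume_cell₃_lt_top γ r w) hbound
    rw [Real.norm_eq_abs, measureReal_def, hvolw] at this
    linarith [this]
  -- summing up
  have hr3Λ : 0 ≤ (r : ℝ) ^ 3 * Λ := by positivity
  have hsum : |∑ w ∈ W, D w| ≤ (W.card : ℝ) * ((r : ℝ) ^ 3 * Λ) +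
      ((W.filter fun w => ¬CellInterior₃ a S₀ γ r w).card : ℝ) * (2 * (r : ℝ) ^ 3 * B) := by
    calc |∑ w ∈ W, D w| ≤ ∑ w ∈ W, |D w| := Finset.abs_sum_le_sum_abs _ _
      _ = ∑ w ∈ W.filter (fun w => CellInterior₃ a S₀ γ r w), |D w| +
            ∑ w ∈ W.filter (fun w => ¬CellInterior₃ a S₀ γ r w), |D w| :=
          (Finset.sum_filter_add_sum_filter_not _ _ _).symm
      _ ≤ ∑ w ∈ W.filter (fun w => CellInterior₃ a S₀ γ r w), (r : ℝ) ^ 3 * Λ +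
            ∑ w ∈ W.filter (fun w => ¬CellInterior₃ a S₀ γ r w), 2 * (r : ℝ) ^ 3 * B := by
          gcongr with w hw w hw
          · rw [Finset.mem_filter] at hw; exact hDint w hw.1 hw.2
          · rw [Finset.mem_filter] at hw; exact hDall w hw.1
      _ = ((W.filter fun w => CellInterior₃ a S₀ γ r w).card : ℝ) * ((r : ℝ) ^ 3 * Λ) +
            ((W.filter fun w => ¬CellInterior₃ a S₀ γ r w).card : ℝ) * (2 * (r : ℝ) ^ 3 * B) := by
          rw [Finset.sum_const, Finset.sum_const, nsmul_eq_mul, nsmul_eq_mul]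
      _ ≤ (W.card : ℝ) * ((r : ℝ) ^ 3 * Λ) +
            ((W.filter fun w => ¬CellInterior₃ a S₀ γ r w).card : ℝ) * (2 * (r : ℝ) ^ 3 * B) := by
          have hcardle : ((W.filter fun w => CellInterior₃ a S₀ γ r w).card : ℝ) ≤ W.card := by
            exact_mod_cast Finset.card_filter_le _ _
          exact add_le_add (mul_le_mul_of_nonneg_right hcardle hr3Λ) le_rfl
  -- counts
  have hWc : (W.card : ℝ) ≤ (S₀ / r + 2) ^ 3 := card_cellWindow₃_le hS₀.le hr
  have hBc : ((W.filter fun w => ¬CellInterior₃ a S₀ γ r w).card : ℝ) ≤ 6 * (S₀ / r + 2) ^ 2 :=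
    card_filter_not_cellInterior₃_le hS₀.le hr
  have hratio : 1 ≤ S₀ / r := by rwa [le_div_iff₀ hr', one_mul]
  have h3 : S₀ / r + 2 ≤ 3 * (S₀ / r) := by linarith
  have h0 : 0 ≤ S₀ / r + 2 := by positivity
  have hfinal : |(r : ℝ) ^ 3 * ∑ w ∈ W.filter (fun w => V w ∈ 𝒞), g (V w) - ∫ x in 𝒞, g x| ≤
      (r : ℝ) ^ 3 * (27 * (S₀ / r) ^ 3 * Λ + 108 * (S₀ / r) ^ 2 * B) := by
    rw [hkey]
    calc |∑ w ∈ W, D w| ≤ (W.card : ℝ) * ((r : ℝ) ^ 3 * Λ) +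
          ((W.filter fun w => ¬CellInterior₃ a S₀ γ r w).card : ℝ) * (2 * (r : ℝ) ^ 3 * B) := hsum
      _ ≤ (S₀ / r + 2) ^ 3 * ((r : ℝ) ^ 3 * Λ) + 6 * (S₀ / r + 2) ^ 2 * (2 * (r : ℝ) ^ 3 * B) := by
          gcongr
      _ ≤ (3 * (S₀ / r)) ^ 3 * ((r : ℝ) ^ 3 * Λ) + 6 * (3 * (S₀ / r)) ^ 2 * (2 * (r : ℝ) ^ 3 * B) := by
          gcongr
      _ = (r : ℝ) ^ 3 * (27 * (S₀ / r) ^ 3 * Λ + 108 * (S₀ / r) ^ 2 * B) := by ring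
  have heq : ∑ w ∈ W.filter (fun w => V w ∈ 𝒞), g (V w) - ((r : ℝ) ^ 3)⁻¹ * ∫ x in 𝒞, g x =
      ((r : ℝ) ^ 3)⁻¹ *
        ((r : ℝ) ^ 3 * ∑ w ∈ W.filter (fun w => V w ∈ 𝒞), g (V w) - ∫ x in 𝒞, g x) := by
    rw [mul_sub, ← mul_assoc, inv_mul_cancel₀ hr3.ne', one_mul]
  rw [heq, abs_mul, abs_of_pos (inv_pos.mpr hr3)]
  calc ((r : ℝ) ^ 3)⁻¹ * |(r : ℝ) ^ 3 * ∑ w ∈ W.filter (fun w => V w ∈ 𝒞), g (V w) - ∫ x in 𝒞, g x|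
      ≤ ((r : ℝ) ^ 3)⁻¹ * ((r : ℝ) ^ 3 * (27 * (S₀ / r) ^ 3 * Λ + 108 * (S₀ / r) ^ 2 * B)) :=
        mul_le_mul_of_nonneg_left hfinal (inv_pos.mpr hr3).le
    _ = 27 * (S₀ / r) ^ 3 * Λ + 108 * (S₀ / r) ^ 2 * B := by field_simp

end Abstract

/-! ### From the lattice points `β̂ ≡ γ̂ (mod r)` of the cube to the cell indices -/

section Reindex

variable {a : ℝ × ℝ × ℝ} {S₀ : ℝ} {γ : ℤ × ℤ × ℤ} {r : ℕ}

/-- The lattice point `γ + rw ∈ γ + rℤ³` of index `w`. [folklore] -/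
def intVertex (γ : ℤ × ℤ × ℤ) (r : ℕ) (w : ℤ × ℤ × ℤ) : ℤ × ℤ × ℤ :=
  (γ.1 + r * w.1, γ.2.1 + r * w.2.1, γ.2.2 + r * w.2.2)

/-- An integer vector as a real vector. [folklore] -/
def castVec (v : ℤ × ℤ × ℤ) : ℝ × ℝ × ℝ := ((v.1 : ℝ), (v.2.1 : ℝ), (v.2.2 : ℝ))

/-- First coordinate of `castVec`. [folklore] -/
@[simp] theorem castVec_fst (v : ℤ × ℤ × ℤ) : (castVec v).1 = v.1 := rfl
/-- Second coordinate of `castVec`. [folklore] -/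
@[simp] theorem castVec_snd_fst (v : ℤ × ℤ × ℤ) : (castVec v).2.1 = v.2.1 := rfl
/-- Third coordinate of `castVec`. [folklore] -/
@[simp] theorem castVec_snd_snd (v : ℤ × ℤ × ℤ) : (castVec v).2.2 = v.2.2 := rfl

/-- The lattice point `γ + rw` as a real vector is the cell vertex. [folklore] -/
theorem castVec_intVertex (γ : ℤ × ℤ × ℤ) (r : ℕ) (w : ℤ × ℤ × ℤ) :
    castVec (intVertex γ r w) = cellVertex₃ γ r w := by
  simp only [castVec, intVertex, cellVertex₃, cellVertex, Int.cast_add, Int.cast_mul, Int.cast_natCast]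

/-- Membership in the lattice cube is membership of the real vector in the cube. [folklore] -/
theorem mem_latticeCube_iff {v : ℤ × ℤ × ℤ} : v ∈ latticeCube a S₀ ↔ castVec v ∈ realCube a S₀ := by
  rw [latticeCube, Finset.mem_product, Finset.mem_product, mem_Ioc_floor_iff, mem_Ioc_floor_iff,
    mem_Ioc_floor_iff, mem_realCube]
  simp only [castVec]

open scoped Classical in
/-- **Reindexing**: the lattice points `v` of the cube with `v ≡ γ (mod r)` coordinatewise are the
vertices `γ + rw` of the cell indices `w` of the window whose vertex lies in the cube. [folklore] -/
theorem sum_latticeCube_filter_modEq_eq (hr : 0 < r) (G : ℤ × ℤ × ℤ → ℝ) :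
    ∑ v ∈ (latticeCube a S₀).filter
        (fun v => (r : ℤ) ∣ v.1 - γ.1 ∧ (r : ℤ) ∣ v.2.1 - γ.2.1 ∧ (r : ℤ) ∣ v.2.2 - γ.2.2), G v =
      ∑ w ∈ (cellWindow₃ a S₀ γ r).filter (fun w => cellVertex₃ γ r w ∈ realCube a S₀),
        G (intVertex γ r w) := by
  have hr0 : (r : ℤ) ≠ 0 := by exact_mod_cast hr.ne'
  refine Finset.sum_nbij' (fun v => ((v.1 - γ.1) / r, (v.2.1 - γ.2.1) / r, (v.2.2 - γ.2.2) / r))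
    (fun w => intVertex γ r w) ?_ ?_ ?_ ?_ ?_
  · intro v hv
    rw [Finset.mem_filter] at hv
    obtain ⟨hv, h1, h2, h3⟩ := hv
    have hcast : cellVertex₃ γ r ((v.1 - γ.1) / r, (v.2.1 - γ.2.1) / r, (v.2.2 - γ.2.2) / r) =
        castVec v := by
      rw [← castVec_intVertex]
      simp only [intVertex, castVec, Int.mul_ediv_cancel' h1, Int.mul_ediv_cancel' h2,
        Int.mul_ediv_cancel' h3, add_sub_cancel]
    have hmem : cellVertex₃ γ r ((v.1 - γ.1) / r, (v.2.1 - γ.2.1) / r, (v.2.2 - γ.2.2) / r) ∈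
        realCube a S₀ := by rw [hcast]; exact mem_latticeCube_iff.mp hv
    rw [Finset.mem_filter]
    exact ⟨mem_cellWindow₃_of_vertex_mem hr hmem, hmem⟩
  · intro w hw
    rw [Finset.mem_filter] at hw
    rw [Finset.mem_filter, mem_latticeCube_iff, castVec_intVertex]
    refine ⟨hw.2, ?_, ?_, ?_⟩ <;> simp [intVertex]
  · intro v hv
    rw [Finset.mem_filter] at hv
    obtain ⟨-, h1, h2, h3⟩ := hv
    simp only [intVertex, Int.mul_ediv_cancel' h1, Int.mul_ediv_cancel' h2, Int.mul_ediv_cancel' h3,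
      add_sub_cancel]
  · intro w _
    simp only [intVertex, add_sub_cancel_left, Int.mul_ediv_cancel_left _ hr0]
  · intro v hv
    rw [Finset.mem_filter] at hv
    obtain ⟨-, h1, h2, h3⟩ := hv
    simp only [intVertex, Int.mul_ediv_cancel' h1, Int.mul_ediv_cancel' h2, Int.mul_ediv_cancel' h3,
      add_sub_cancel]

open scoped Classical in
/-- The abstract comparison for the lattice sum `∑_{v ∈ 𝒞 ∩ ℤ³, v ≡ γ (mod r)} g(v)` itself.
[folklore] -/
theorem abs_sum_latticeCube_sub_integral_le (hr : 0 < r) (hrS : (r : ℝ) ≤ S₀) {g : ℝ × ℝ × ℝ → ℝ}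
    (hg : IntegrableOn g (realCube a S₀)) {B Λ : ℝ} (hB0 : 0 ≤ B) (hΛ0 : 0 ≤ Λ)
    (hB : ∀ x ∈ realCube a S₀, |g x| ≤ B)
    (hΛ : ∀ x ∈ realCube a S₀, ∀ y ∈ realCube a S₀, |x.1 - y.1| ≤ r → |x.2.1 - y.2.1| ≤ r →
      |x.2.2 - y.2.2| ≤ r → |g x - g y| ≤ Λ) :
    |∑ v ∈ (latticeCube a S₀).filter
          (fun v => (r : ℤ) ∣ v.1 - γ.1 ∧ (r : ℤ) ∣ v.2.1 - γ.2.1 ∧ (r : ℤ) ∣ v.2.2 - γ.2.2),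
          g (castVec v) -
        ((r : ℝ) ^ 3)⁻¹ * ∫ x in realCube a S₀, g x| ≤
      27 * (S₀ / r) ^ 3 * Λ + 108 * (S₀ / r) ^ 2 * B := by
  rw [sum_latticeCube_filter_modEq_eq hr]
  simp only [castVec_intVertex]
  exact abs_sum_cellVertex_sub_integral_le hr hrS hg hB0 hΛ0 hB hΛ

end Reindex

/-! ### The norm form on the cube: a Lipschitz bound -/

section NormForm

/-- `|N(𝐱) − N(𝐲)| ≤ 39R²δ` when all coordinates of `𝐱`, `𝐲` are at most `R` in absolute value and
differ by at most `δ` (p. 49: "`N(𝐱) = N(β) + O(V^{2/3}r)` for any `𝐱 ∈ C(β)`"). [cite: HeathBrownActa2001, §8 p. 49] -/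
theorem abs_normForm_sub_le {x y : ℝ × ℝ × ℝ} {R δ : ℝ}
    (hx : |x.1| ≤ R ∧ |x.2.1| ≤ R ∧ |x.2.2| ≤ R) (hy : |y.1| ≤ R ∧ |y.2.1| ≤ R ∧ |y.2.2| ≤ R)
    (hd : |x.1 - y.1| ≤ δ ∧ |x.2.1 - y.2.1| ≤ δ ∧ |x.2.2 - y.2.2| ≤ δ) :
    |normForm x - normForm y| ≤ 39 * R ^ 2 * δ := by
  obtain ⟨hx1, hx2, hx3⟩ := hx
  obtain ⟨hy1, hy2, hy3⟩ := hy
  obtain ⟨hd1, hd2, hd3⟩ := hd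
  have hR : 0 ≤ R := (abs_nonneg _).trans hx1
  have hδ : 0 ≤ δ := (abs_nonneg _).trans hd1
  -- the quadratic factors
  have hQ : ∀ s t : ℝ, |s| ≤ R → |t| ≤ R → |s ^ 2 + s * t + t ^ 2| ≤ 3 * R ^ 2 := by
    intro s t hs ht
    calc |s ^ 2 + s * t + t ^ 2| ≤ |s ^ 2| + |s * t| + |t ^ 2| := abs_add_three _ _ _
      _ = |s| ^ 2 + |s| * |t| + |t| ^ 2 := by rw [abs_pow, abs_mul, abs_pow]
      _ ≤ R ^ 2 + R * R + R ^ 2 := by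
          gcongr
      _ = 3 * R ^ 2 := by ring
  have hP : ∀ s t : ℝ, |s| ≤ R → |t| ≤ R → |s * t| ≤ R ^ 2 := by
    intro s t hs ht
    rw [abs_mul, sq]
    exact mul_le_mul hs ht (abs_nonneg _) hR
  have key : normForm x - normForm y =
      (x.1 - y.1) * (x.1 ^ 2 + x.1 * y.1 + y.1 ^ 2) +
        2 * ((x.2.1 - y.2.1) * (x.2.1 ^ 2 + x.2.1 * y.2.1 + y.2.1 ^ 2)) +
        4 * ((x.2.2 - y.2.2) * (x.2.2 ^ 2 + x.2.2 * y.2.2 + y.2.2 ^ 2)) -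
        6 * ((x.1 - y.1) * (x.2.1 * x.2.2) + (x.2.1 - y.2.1) * (y.1 * x.2.2) +
          (x.2.2 - y.2.2) * (y.1 * y.2.1)) := by
    simp only [normForm]; ring
  have h1 : |(x.1 - y.1) * (x.1 ^ 2 + x.1 * y.1 + y.1 ^ 2)| ≤ δ * (3 * R ^ 2) := by
    rw [abs_mul]; exact mul_le_mul hd1 (hQ _ _ hx1 hy1) (abs_nonneg _) hδ
  have h2 : |(x.2.1 - y.2.1) * (x.2.1 ^ 2 + x.2.1 * y.2.1 + y.2.1 ^ 2)| ≤ δ * (3 * R ^ 2) := by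
    rw [abs_mul]; exact mul_le_mul hd2 (hQ _ _ hx2 hy2) (abs_nonneg _) hδ
  have h3 : |(x.2.2 - y.2.2) * (x.2.2 ^ 2 + x.2.2 * y.2.2 + y.2.2 ^ 2)| ≤ δ * (3 * R ^ 2) := by
    rw [abs_mul]; exact mul_le_mul hd3 (hQ _ _ hx3 hy3) (abs_nonneg _) hδ
  have h4 : |(x.1 - y.1) * (x.2.1 * x.2.2)| ≤ δ * R ^ 2 := by
    rw [abs_mul]; exact mul_le_mul hd1 (hP _ _ hx2 hx3) (abs_nonneg _) hδ
  have h5 : |(x.2.1 - y.2.1) * (y.1 * x.2.2)| ≤ δ * R ^ 2 := by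
    rw [abs_mul]; exact mul_le_mul hd2 (hP _ _ hy1 hx3) (abs_nonneg _) hδ
  have h6 : |(x.2.2 - y.2.2) * (y.1 * y.2.1)| ≤ δ * R ^ 2 := by
    rw [abs_mul]; exact mul_le_mul hd3 (hP _ _ hy1 hy2) (abs_nonneg _) hδ
  rw [key]
  calc |(x.1 - y.1) * (x.1 ^ 2 + x.1 * y.1 + y.1 ^ 2) +
        2 * ((x.2.1 - y.2.1) * (x.2.1 ^ 2 + x.2.1 * y.2.1 + y.2.1 ^ 2)) +
        4 * ((x.2.2 - y.2.2) * (x.2.2 ^ 2 + x.2.2 * y.2.2 + y.2.2 ^ 2)) -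
        6 * ((x.1 - y.1) * (x.2.1 * x.2.2) + (x.2.1 - y.2.1) * (y.1 * x.2.2) +
          (x.2.2 - y.2.2) * (y.1 * y.2.1))|
      ≤ |(x.1 - y.1) * (x.1 ^ 2 + x.1 * y.1 + y.1 ^ 2)| +
        |2 * ((x.2.1 - y.2.1) * (x.2.1 ^ 2 + x.2.1 * y.2.1 + y.2.1 ^ 2))| +
        |4 * ((x.2.2 - y.2.2) * (x.2.2 ^ 2 + x.2.2 * y.2.2 + y.2.2 ^ 2))| +
        |6 * ((x.1 - y.1) * (x.2.1 * x.2.2) + (x.2.1 - y.2.1) * (y.1 * x.2.2) +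
          (x.2.2 - y.2.2) * (y.1 * y.2.1))| := by
        refine (abs_sub _ _).trans ?_
        gcongr
        exact abs_add_three _ _ _
    _ ≤ δ * (3 * R ^ 2) + 2 * (δ * (3 * R ^ 2)) + 4 * (δ * (3 * R ^ 2)) +
        6 * (δ * R ^ 2 + δ * R ^ 2 + δ * R ^ 2) := by
        rw [abs_mul (2 : ℝ), abs_mul (4 : ℝ), abs_mul (6 : ℝ), abs_two, abs_of_pos (by norm_num : (0:ℝ) < 4),
          abs_of_pos (by norm_num : (0:ℝ) < 6)]
        gcongr
        exact (abs_add_three _ _ _).trans (add_le_add (add_le_add h4 h5) h6)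
    _ = 39 * R ^ 2 * δ := by ring

/-- The norm form is continuous. [folklore] -/
theorem continuous_normForm : Continuous normForm := by
  unfold normForm; fun_prop

end NormForm

/-! ### (8.5): the residue-class sums of `w'(N(β))` over the cube -/

section EightFive

variable {X τ : ℝ}

/-- The cube has volume `S₀³` (`S₀ ≥ 0`). [folklore] -/
theorem volume_realCube (a : ℝ × ℝ × ℝ) {S₀ : ℝ} (hS₀ : 0 ≤ S₀) :
    volume (realCube a S₀) = ENNReal.ofReal (S₀ ^ 3) := by
  rw [realCube, Measure.volume_eq_prod, Measure.prod_prod, Measure.volume_eq_prod, Measure.prod_prod]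
  simp only [Real.volume_Ioc, add_sub_cancel_left]
  rw [← ENNReal.ofReal_mul hS₀, ← ENNReal.ofReal_mul hS₀]
  ring_nf

/-- `w'(N(𝐱), 𝐦)` is integrable on the cube (`X ≥ 1`, `τ ≥ 0`: measurable and bounded by (8.4)).
[folklore] -/
theorem integrableOn_wDeriv_normForm (hX : 1 ≤ X) (hτ : 0 ≤ τ) {n : ℕ} (m : Fin (n + 1) → ℕ)
    (a : ℝ × ℝ × ℝ) {S₀ : ℝ} (hS₀ : 0 ≤ S₀) :
    IntegrableOn (fun p => wDeriv X τ m (normForm p)) (realCube a S₀) := by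
  have hX0 : 0 < X := by linarith
  haveI : IsFiniteMeasure ((volume : Measure (ℝ × ℝ × ℝ)).restrict (realCube a S₀)) :=
    ⟨by rw [Measure.restrict_apply_univ, volume_realCube a hS₀]; exact ENNReal.ofReal_lt_top⟩
  have hmeas : Measurable fun p : ℝ × ℝ × ℝ => wDeriv X τ m (normForm p) :=
    (measurable_wDeriv X τ m).comp continuous_normForm.measurable
  refine Integrable.mono' (integrable_const ((hbXi τ * Real.log X) ^ n)) hmeas.aestronglyMeasurable
    (Eventually.of_forall fun p => ?_)
  rw [Real.norm_eq_abs, abs_of_nonneg (wDeriv_nonneg hX0 m _)]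
  exact wDeriv_le hX hτ m _

open scoped Classical in
/-- **Heath-Brown's (8.5)** (p. 49), the case `n ≥ 1`: for a cube `𝒞` as in Lemma 3.8 (on which
`x, y, z ≪ V^{1/3}` and `N(𝐱) ≫ V`, constants `c₃, c₄`), a rational integer `1 ≤ r ≤ S₀` and any class
`γ̂ (mod r)`,
`∑_{β̂ ∈ 𝒞, β̂ ≡ γ̂ (mod r)} w'(N(β̂)) = r⁻³ 𝓘 + O(V^{−1/3} r (ξ log X)^{n−1} (S₀/r)³) + O(r⁻³ · rS₀² · (ξ log X)^n)`
("`N(𝐱) = N(β) + O(V^{2/3}r)` for any `𝐱 ∈ C(β)`. Thus (8.3) shows that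
`w'(N(𝐱)) = w'(N(β)) + O(V^{−1/3}r(ξ log X)^{n−1})` … The cubes `C(β)` for `β ≡ γ (mod r)` will be
disjoint … as `β` runs over `𝒞` the union of the cubes `C(β)` will be a set which differs from `𝒞`
only at points within a distance `O(r)` of the boundary. Since `r ≤ S₀` it follows that
`∑ w'(N(β)) = r⁻³ ∑ ∫_{C(β)} w'(N(𝐱)) + O(V^{−1/3}r(ξ log X)^{n−1}(S₀/r)³) = r⁻³ ∫_𝒞 w'(N(𝐱)) + O(r⁻³·rS₀²·(ξ log X)^n) + O(…)`"),
with explicit constants: here `𝐦` has length `n + 2` (the paper's `n + 1 ≥ 2`), `𝓘 = cubeIntegral`,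
and the bound reads `2106 (c₃²/c₄) (S₀³/r²) V^{−1/3} (ξ log X)^n + 108 (S₀²/r²) (ξ log X)^{n+1}`
(from (8.3) in the form `abs_wDeriv_sub_wDeriv_le`, (8.4) `wDeriv_le`, `|N(𝐱) − N(𝐲)| ≤ 39(c₃V^{1/3})²r`,
`N ≥ c₄V` on `𝒞`, and `abs_sum_latticeCube_sub_integral_le`). The paper's final shape
`r⁻³𝓘 + O(r⁻²S₀²(ξ log X)^n)` uses in addition `S₀ ≪ V^{1/3}` and `ξ log X ≫ 1`, which belong to the
application. [cite: HeathBrownActa2001, §8 (8.5)] -/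
theorem HeathBrown2001_eq_8_5 (hX : 1 ≤ X) (hτ : 0 ≤ τ) {n : ℕ} (m : Fin (n + 2) → ℕ)
    {c₃ c₄ V : ℝ} (hc₄ : 0 < c₄) (hV : 0 < V) {a : ℝ × ℝ × ℝ} {S₀ : ℝ}
    (hcube : CubeCond c₃ c₄ V a S₀) {r : ℕ} (hr : 0 < r) (hrS : (r : ℝ) ≤ S₀) (γ : ℤ × ℤ × ℤ) :
    |∑ v ∈ (latticeCube a S₀).filter
          (fun v => (r : ℤ) ∣ v.1 - γ.1 ∧ (r : ℤ) ∣ v.2.1 - γ.2.1 ∧ (r : ℤ) ∣ v.2.2 - γ.2.2),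
          wDeriv X τ m (normForm (castVec v)) -
        ((r : ℝ) ^ 3)⁻¹ * cubeIntegral X τ m a S₀| ≤
      2106 * (c₃ ^ 2 / c₄) * (S₀ ^ 3 / r ^ 2) * V ^ (-(1 / 3 : ℝ)) * (hbXi τ * Real.log X) ^ n +
        108 * (S₀ ^ 2 / r ^ 2) * (hbXi τ * Real.log X) ^ (n + 1) := by
  have hX0 : 0 < X := by linarith
  have hr' : (0 : ℝ) < r := by exact_mod_cast hr
  have hS₀ : 0 < S₀ := hr'.trans_le hrS
  have hξL : 0 ≤ hbXi τ * Real.log X := mul_nonneg (pow_nonneg hτ 5) (Real.log_nonneg hX)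
  set R : ℝ := c₃ * V ^ (1 / 3 : ℝ) with hR
  set Λ : ℝ := 78 * (c₃ ^ 2 / c₄) * r * V ^ (-(1 / 3 : ℝ)) * (hbXi τ * Real.log X) ^ n with hΛ
  set B : ℝ := (hbXi τ * Real.log X) ^ (n + 1) with hB
  have hB0 : 0 ≤ B := pow_nonneg hξL _
  have hΛ0 : 0 ≤ Λ := by positivity
  -- the two hypotheses of the abstract lemma
  have hBg : ∀ x ∈ realCube a S₀, |wDeriv X τ m (normForm x)| ≤ B := fun x _ => by
    rw [abs_of_nonneg (wDeriv_nonneg hX0 m _)]; exact wDeriv_le hX hτ m _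
  have hR2 : R ^ 2 = c₃ ^ 2 * V ^ (2 / 3 : ℝ) := by
    rw [hR, mul_pow]
    congr 1
    rw [← Real.rpow_natCast, ← Real.rpow_mul hV.le]; norm_num
  have hV23 : V ^ (2 / 3 : ℝ) / V = V ^ (-(1 / 3 : ℝ)) := by
    rw [div_eq_mul_inv, ← Real.rpow_neg_one V, ← Real.rpow_add hV]; norm_num
  have hΛg : ∀ x ∈ realCube a S₀, ∀ y ∈ realCube a S₀, |x.1 - y.1| ≤ r → |x.2.1 - y.2.1| ≤ r →
      |x.2.2 - y.2.2| ≤ r → |wDeriv X τ m (normForm x) - wDeriv X τ m (normForm y)| ≤ Λ := by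
    -- first for `N(x) ≤ N(y)`
    have key : ∀ x ∈ realCube a S₀, ∀ y ∈ realCube a S₀, |x.1 - y.1| ≤ r → |x.2.1 - y.2.1| ≤ r →
        |x.2.2 - y.2.2| ≤ r → normForm x ≤ normForm y →
        |wDeriv X τ m (normForm y) - wDeriv X τ m (normForm x)| ≤ Λ := by
      intro x hx y hy h1 h2 h3 hle
      obtain ⟨hx1, hx2, hx3, hxN⟩ := hcube x hx
      obtain ⟨hy1, hy2, hy3, -⟩ := hcube y hy
      have hNx : c₄ * V ≤ normForm x := hxN
      have hNx0 : 0 < normForm x := lt_of_lt_of_le (mul_pos hc₄ hV) hNx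
      have hdiff : normForm y - normForm x ≤ 39 * R ^ 2 * r := by
        have := abs_normForm_sub_le (R := R) (δ := r) ⟨hy1, hy2, hy3⟩ ⟨hx1, hx2, hx3⟩
          ⟨by rw [abs_sub_comm]; exact h1, by rw [abs_sub_comm]; exact h2, by rw [abs_sub_comm]; exact h3⟩
        exact (le_abs_self _).trans this
      calc |wDeriv X τ m (normForm y) - wDeriv X τ m (normForm x)|
          ≤ 2 * ((normForm y - normForm x) / normForm x) * (hbXi τ * Real.log X) ^ n :=
            abs_wDeriv_sub_wDeriv_le hX hτ m hNx0 hle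
        _ ≤ 2 * (39 * R ^ 2 * r / (c₄ * V)) * (hbXi τ * Real.log X) ^ n := by
            gcongr _ * ?_ * _
            calc (normForm y - normForm x) / normForm x ≤ (39 * R ^ 2 * r) / normForm x :=
                  div_le_div_of_nonneg_right hdiff hNx0.le
              _ ≤ 39 * R ^ 2 * r / (c₄ * V) := by
                  apply div_le_div_of_nonneg_left _ (mul_pos hc₄ hV) hNx
                  rw [hR2]; positivity
        _ = Λ := by
            rw [hΛ, hR2]
            field_simp
            rw [← hV23]
            field_simp
            ring
    intro x hx y hy h1 h2 h3
    rcases le_total (normForm x) (normForm y) with hle | hle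
    · rw [abs_sub_comm]; exact key x hx y hy h1 h2 h3 hle
    · refine key y hy x hx ?_ ?_ ?_ hle <;> rw [abs_sub_comm]
      exacts [h1, h2, h3]
  have h := abs_sum_latticeCube_sub_integral_le (γ := γ) hr hrS
    (integrableOn_wDeriv_normForm hX hτ m a hS₀.le) hB0 hΛ0 hBg hΛg
  refine h.trans (le_of_eq ?_)
  rw [hΛ, hB]
  field_simp
  ring

end EightFive

/-! ### `β ≡ α (mod q)` in `ℤ[2^{1/3}]` is a coordinatewise congruence -/

section Bridge

open NumberField LFunctions.CubeRootTwoField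

/-- The coordinates of `β = a + bθ + cθ²` in the integral basis `1, θ, θ²` (`basis3` of
`HeathBrownCubicLatticeCount`) are `(a, b, c)`. [folklore] -/
theorem repr_coordElt (v : ℤ × ℤ × ℤ) : ⇑(basis3.repr (coordElt v)) = coordFun v := by
  rw [coordElt_eq_sum_smul, Module.Basis.repr_sum_self]

/-- **A rational integer `q` divides `β = a + bθ + cθ²` in `𝓞_K` iff `q ∣ a, b, c`** (`1, θ, θ²` is an
integral basis). [folklore] -/
theorem natCast_dvd_coordElt_iff {q : ℕ} {v : ℤ × ℤ × ℤ} :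
    (q : 𝓞 K) ∣ coordElt v ↔ (q : ℤ) ∣ v.1 ∧ (q : ℤ) ∣ v.2.1 ∧ (q : ℤ) ∣ v.2.2 := by
  constructor
  · rintro ⟨t, ht⟩
    have h : ∀ i, coordFun v i = q * basis3.repr t i := fun i => by
      rw [← repr_coordElt, ht, show ((q : 𝓞 K)) * t = (q : ℤ) • t by rw [zsmul_eq_mul, Int.cast_natCast],
        LinearEquiv.map_smul, Finsupp.smul_apply, smul_eq_mul]
    exact ⟨⟨_, h 0⟩, ⟨_, h 1⟩, ⟨_, h 2⟩⟩
  · rintro ⟨⟨d₁, h₁⟩, ⟨d₂, h₂⟩, ⟨d₃, h₃⟩⟩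
    refine ⟨coordElt (d₁, d₂, d₃), ?_⟩
    simp only [coordElt, h₁, h₂, h₃, Int.cast_mul, Int.cast_natCast]
    ring

open scoped Classical in
/-- The congruence `β ≡ α (mod q)` (`q ∣ β − α` in `𝓞_K`) for `α = coordElt γ̂` is the coordinatewise
congruence `β̂ ≡ γ̂ (mod q)`. [folklore] -/
theorem filter_dvd_coordElt_sub (s : Finset (ℤ × ℤ × ℤ)) (q : ℕ) (γ : ℤ × ℤ × ℤ) :
    s.filter (fun v => (q : 𝓞 K) ∣ coordElt v - coordElt γ) =
      s.filter (fun v => (q : ℤ) ∣ v.1 - γ.1 ∧ (q : ℤ) ∣ v.2.1 - γ.2.1 ∧ (q : ℤ) ∣ v.2.2 - γ.2.2) := by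
  refine Finset.filter_congr fun v _ => ?_
  rw [← coordElt_sub, natCast_dvd_coordElt_iff]
  rfl

open scoped Classical in
/-- The residue-class cube sum for `α = coordElt γ̂` as a sum over `β̂ ≡ γ̂ (mod q)` coordinatewise
(every `α ∈ 𝓞_K` is of this form, `coordElt_surjective`). [cite: HeathBrownActa2001, Lemma 3.8] -/
theorem cubeClassSum_coordElt (w : Ideal (𝓞 K) → ℝ) (q : ℕ) (γ : ℤ × ℤ × ℤ) (a : ℝ × ℝ × ℝ)
    (S₀ : ℝ) :
    cubeClassSum w q (coordElt γ) a S₀ =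
      ∑ v ∈ (latticeCube a S₀).filter
        (fun v => (q : ℤ) ∣ v.1 - γ.1 ∧ (q : ℤ) ∣ v.2.1 - γ.2.1 ∧ (q : ℤ) ∣ v.2.2 - γ.2.2),
        w (Ideal.span {coordElt v}) := by
  unfold cubeClassSum
  rw [filter_dvd_coordElt_sub]

end Bridge

end Literature.NumberTheory.Sieve.CubicSieve

end
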